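import Mathlib
import Summits.Ventures.HodgeRepro2.T5CyclicSubquotientUnique

/-!
# THE SPHERICAL LAYER IS UNIQUE: IN ANY FILTRATION OF `⟨G v₀⟩` THE `K`-INVARIANTS LIVE IN ONE LAYER

Tier-5 support N3 / §G-N4.2 (seat p3, gen 85). Files 336–338 built the spherical subquotient `⟨G v₀⟩ / N` and
showed it is the same `π_{χ_λ}` for every maximal `N ∌ v₀`. This file is the multiplicity-one statement in
elementary form: for `G`-stable subspaces `B ≤ A ≤ ⟨G v₀⟩`, the layer `A / B` carries a non-zero `K`-invariant
vector (an `a ∈ A \ B` with `κ a − a ∈ B` for all `κ ∈ K`) IF AND ONLY IF `v₀ ∈ A \ B` — and then `A = ⟨G v₀⟩`.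
So in any chain `⊥ = N₀ ≤ N₁ ≤ … ≤ N_r = ⟨G v₀⟩` of `G`-stable subspaces exactly one layer sees the
`K`-invariants: the top layer `N_i / N_{i−1}` with `v₀ ∈ N_i \ N_{i−1}`, and `N_i = ⟨G v₀⟩`.

* generic (`ρ` on `V`, `K` with finite orbits): **`kFinite_toRepresentation`** — a subrepresentation of a
  `K`-finite representation is `K`-finite; **`levelAverage_mem_of_mem`** — the level average of a vector of a
  subrepresentation stays in it; **`levelAverage_sub_mem`** — if `κ a − a ∈ N` for all `κ ∈ K` (`N` stable) then
  `levelAverage a − a ∈ N` (p8's `map_levelAverage'` through the projection onto `V / N`);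
* for `⟨G v₀⟩` (every `K`-invariant of `⟨G v₀⟩` a multiple of `v₀`): **`gen_mem_and_notMem_of_layer`** — a layer
  `A / B` with a non-zero `K`-invariant has `v₀ ∈ A \ B`; **`eq_top_of_layer`** — and `A = ⟨G v₀⟩`;
  **`layer_iff`** — the characterisation «`A / B` has a non-zero `K`-invariant ⟺ `v₀ ∈ A \ B`»;
* inert (`ρ = rightRegular`, `v₀ = sphericalVector (α q⁻²)`): **`layer_iff_sphericalVector`** — the same on
  `⟨G f₀⟩ ⊆ I(α q⁻²)`; with file 338, the unique layer carrying the `K`-invariants, when irreducible, is `π_{χ_λ}`.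

Nothing here is a statement about (P), theta lifts or L-values. §8(d): uses an L-value-free non-vanishing
device: NO.
-/

open Summit.Ventures.HodgeRepro2.T5HeckeBasisCells Summit.Ventures.HodgeRepro2.T5HeckePermutationModule
  Summit.Ventures.HodgeRepro2.LevelPositivity Summit.Ventures.HodgeRepro2.T5UnitaryGroupForm
  Summit.Ventures.HodgeRepro2.T5HermitianThreeElements Summit.Ventures.HodgeRepro2.T5UnitaryHeckeAdjoint
  Summit.Ventures.HodgeRepro2.T5InertUnipotentResidue Summit.Ventures.HodgeRepro2.T5InertSatakeTransform
  Summit.Ventures.HodgeRepro2.T5InertPrincipalSeries Summit.Ventures.HodgeRepro2.T5InertIwasawa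
  Summit.Ventures.HodgeRepro2.T5HeckeDoubleCoset Summit.Ventures.HodgeRepro2.T5InertUnipotentRadical
  Summit.Ventures.HodgeRepro2.T5InertIwasawaCosets Summit.Ventures.HodgeRepro2.T5InertSphericalClassification
  Summit.Ventures.HodgeRepro2.T5InertSphericalVector Summit.Ventures.HodgeRepro2.T5CyclicSubquotient
  Summit.Ventures.HodgeRepro2.T5LevelIdempotent Summit.Ventures.HodgeRepro2.T5HeckeCommutativeMultiplicityOne
  Summit.Ventures.HodgeRepro2.T5HeckeInducedIrreducible Summit.Ventures.HodgeRepro2.T5HeckeCharacterRepresentation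
  Summit.Ventures.HodgeRepro2.T5InertHeckeCharacter Summit.Ventures.HodgeRepro2.T5LevelIdempotentNaturality
  Summit.Ventures.HodgeRepro2.T5InertSphericalSubquotient Summit.Ventures.HodgeRepro2.T5CyclicSubquotientUnique

namespace Summit.Ventures.HodgeRepro2.T5CyclicSubquotientLayer

section Generic

variable {G : Type*} [Group G] {k : Type*} [Field k] {V : Type*} [AddCommGroup V] [Module k V]
  (ρ : Representation k G V) {K : Subgroup G}

/-- The action of a subrepresentation is the restriction of `ρ`. -/
theorem coe_toRepresentation_apply (S : Subrepresentation ρ) (g : G) (w : S.toSubmodule) :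
    ((S.toRepresentation g w : S.toSubmodule) : V) = ρ g (w : V) := rfl

/-- Stabilisers in a subrepresentation are stabilisers in `V`. -/
theorem stabilizerIn_toRepresentation (S : Subrepresentation ρ) (w : S.toSubmodule) :
    stabilizerIn S.toRepresentation K w = stabilizerIn ρ K (w : V) := by
  ext κ
  rw [mem_stabilizerIn_iff, mem_stabilizerIn_iff, ← Subtype.coe_inj, coe_toRepresentation_apply]

/-- **A subrepresentation of a `K`-finite representation is `K`-finite.** -/
theorem kFinite_toRepresentation (S : Subrepresentation ρ) (hK : KFinite ρ K) :
    KFinite S.toRepresentation K := by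
  intro w
  rw [stabilizerIn_toRepresentation]
  exact hK w

variable [CharZero k]

/-- **The level average of a vector of a subrepresentation stays in it** (naturality of the level average along
the inclusion, p8's `map_levelAverage'`). -/
theorem levelAverage_mem_of_mem (S : Subrepresentation ρ) (hK : KFinite ρ K) {a : V} (ha : a ∈ S.toSubmodule) :
    levelAverage ρ K a ∈ S.toSubmodule := by
  have hι : ∀ (g : G) (w : S.toSubmodule),
      S.toSubmodule.subtype (S.toRepresentation g w) = ρ g (S.toSubmodule.subtype w) := fun _ _ => rfl
  have h := map_levelAverage' (σ := ρ) (f := S.toSubmodule.subtype) hι (kFinite_toRepresentation ρ S hK) ⟨a, ha⟩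
  rw [show S.toSubmodule.subtype ⟨a, ha⟩ = a from rfl] at h
  rw [← h]
  exact (levelAverage S.toRepresentation K ⟨a, ha⟩).2

/-- **`κ a − a ∈ N` for all `κ ∈ K` forces `levelAverage a − a ∈ N`** (`N` a `G`-stable subspace): the class of `a`
is `K`-invariant in `V / N`, so it is its own level average, which is the class of the level average of `a`. -/
theorem levelAverage_sub_mem (N : Submodule k V) (hN : ∀ (g : G) ⦃w : V⦄, w ∈ N → ρ g w ∈ N)
    (hK : KFinite ρ K) {a : V} (ha : ∀ κ ∈ K, ρ κ a - a ∈ N) : levelAverage ρ K a - a ∈ N := by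
  have hinv : N.mkQ a ∈ invariants (quotientBySub ρ N hN) K := by
    rw [mem_invariants_iff]
    intro κ hκ
    rw [Submodule.mkQ_apply, quotientRep_mk, ← sub_eq_zero, ← Submodule.Quotient.mk_sub,
      Submodule.Quotient.mk_eq_zero]
    exact ha κ hκ
  have h := map_levelAverage' (σ := quotientBySub ρ N hN) (f := N.mkQ) (mkQ_equivariant ρ N hN) hK a
  rw [levelAverage_of_mem_invariants hinv] at h
  rw [← Submodule.Quotient.mk_eq_zero, Submodule.Quotient.mk_sub, sub_eq_zero, ← Submodule.mkQ_apply,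
    ← Submodule.mkQ_apply, h]

end Generic

section Cyclic

variable {G : Type*} [Group G] {k : Type*} [Field k] [CharZero k] {V : Type*} [AddCommGroup V] [Module k V]
  (ρ : Representation k G V) {K : Subgroup G} (v₀ : V) (hv₀ : v₀ ∈ invariants ρ K)
  (hfin : ∀ g : G, Finite (MulAction.orbit K (g : G ⧸ K)))
  (hC : ∀ w ∈ cyclicSpan ρ v₀ hv₀, w ∈ invariants ρ K → ∃ a : k, w = a • v₀)
  (A B : Submodule k (cyclicSpan ρ v₀ hv₀))
  (hA : ∀ (g : G) ⦃w : cyclicSpan ρ v₀ hv₀⦄, w ∈ A → cyclicRep ρ v₀ hv₀ g w ∈ A)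
  (hB : ∀ (g : G) ⦃w : cyclicSpan ρ v₀ hv₀⦄, w ∈ B → cyclicRep ρ v₀ hv₀ g w ∈ B)

include hfin hC hA hB in
/-- **A LAYER `A / B` OF `⟨G v₀⟩` WITH A NON-ZERO `K`-INVARIANT CONTAINS `v₀` IN `A \ B`**: the level average of
such an `a ∈ A \ B` lies in `A`, differs from `a` by an element of `B`, and is a `K`-invariant of `⟨G v₀⟩`, hence
a non-zero multiple of `v₀`. -/
theorem gen_mem_and_notMem_of_layer {a : cyclicSpan ρ v₀ hv₀} (haA : a ∈ A) (haB : a ∉ B)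
    (hinv : ∀ κ ∈ K, cyclicRep ρ v₀ hv₀ κ a - a ∈ B) : gen ρ v₀ hv₀ ∈ A ∧ gen ρ v₀ hv₀ ∉ B := by
  have hK := kFinite_cyclicRep ρ v₀ hv₀ hfin
  haveI := hK a
  set e := levelAverage (cyclicRep ρ v₀ hv₀) K a with he
  have heA : e ∈ A :=
    levelAverage_mem_of_mem (cyclicRep ρ v₀ hv₀) ⟨A, fun g _ hw => hA g hw⟩ hK haA
  have heB : e - a ∈ B := levelAverage_sub_mem (cyclicRep ρ v₀ hv₀) B hB hK hinv
  have heK : e ∈ invariants (cyclicRep ρ v₀ hv₀) K := levelAverage_mem_invariants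
  have heK' : (e : V) ∈ invariants ρ K := by
    rw [mem_invariants_iff] at heK ⊢
    intro κ hκ
    rw [← coe_cyclicRep_apply, heK κ hκ]
  obtain ⟨t, ht⟩ := hC _ e.2 heK'
  have hte : e = t • gen ρ v₀ hv₀ := Subtype.ext ht
  have heB' : e ∉ B := fun h => haB (by
    have : a = e - (e - a) := by abel
    rw [this]
    exact B.sub_mem h heB)
  have ht0 : t ≠ 0 := by
    rintro rfl
    exact heB' (by rw [hte, zero_smul]; exact B.zero_mem)
  have hgen : gen ρ v₀ hv₀ = t⁻¹ • e := by rw [hte, smul_smul, inv_mul_cancel₀ ht0, one_smul]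
  refine ⟨by rw [hgen]; exact A.smul_mem _ heA, fun h => heB' ?_⟩
  rw [hte]
  exact B.smul_mem _ h

include hfin hC hA hB in
/-- **The layer carrying the `K`-invariants is the top layer**: `A = ⟨G v₀⟩`. -/
theorem eq_top_of_layer {a : cyclicSpan ρ v₀ hv₀} (haA : a ∈ A) (haB : a ∉ B)
    (hinv : ∀ κ ∈ K, cyclicRep ρ v₀ hv₀ κ a - a ∈ B) : A = ⊤ :=
  eq_top_of_gen_mem ρ v₀ hv₀ hA (gen_mem_and_notMem_of_layer ρ v₀ hv₀ hfin hC A B hA hB haA haB hinv).1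

omit [CharZero k] in
/-- `v₀ ∈ A \ B` gives the non-zero `K`-invariant class of `v₀` in `A / B` (the converse direction; needs no
stability). -/
theorem exists_layer_of_gen_mem (hgA : gen ρ v₀ hv₀ ∈ A) (hgB : gen ρ v₀ hv₀ ∉ B) :
    ∃ a ∈ A, a ∉ B ∧ ∀ κ ∈ K, cyclicRep ρ v₀ hv₀ κ a - a ∈ B :=
  ⟨gen ρ v₀ hv₀, hgA, hgB, fun κ hκ => by
    rw [(mem_invariants_iff.1 (gen_mem_invariants ρ v₀ hv₀)) κ hκ, sub_self]
    exact B.zero_mem⟩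

include hfin hC hA hB in
/-- **THE SPHERICAL LAYER, CHARACTERISED**: a layer `A / B` of `⟨G v₀⟩` (`G`-stable `B ≤ A`, the inequality not even
needed) carries a non-zero `K`-invariant vector iff `v₀ ∈ A \ B`. -/
theorem layer_iff :
    (∃ a ∈ A, a ∉ B ∧ ∀ κ ∈ K, cyclicRep ρ v₀ hv₀ κ a - a ∈ B) ↔ gen ρ v₀ hv₀ ∈ A ∧ gen ρ v₀ hv₀ ∉ B :=
  ⟨fun ⟨_, haA, haB, hinv⟩ => gen_mem_and_notMem_of_layer ρ v₀ hv₀ hfin hC A B hA hB haA haB hinv,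
    fun ⟨hgA, hgB⟩ => exists_layer_of_gen_mem ρ v₀ hv₀ A B hgA hgB⟩

end Cyclic

section Inert

variable {R E : Type*} [CommRing R] [Field E] [StarRing E] [Algebra R E] [IsFractionRing R E] [IsDomain R]
  [IsDiscreteValuationRing R] [Finite (IsLocalRing.ResidueField R)]
  (hstar : ∀ x : E, IsLocalization.IsInteger R x → IsLocalization.IsInteger R (star x))
  (u : E) (hsu : star u = u) (hu0 : u ≠ 0) (hu : IsLocalization.IsInteger R u)
  (hu' : IsLocalization.IsInteger R u⁻¹) {ϖ : R} (hϖ : Irreducible ϖ)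
  (hs : star (algebraMap R E ϖ) = algebraMap R E ϖ) (k : Type*) [Field k] [CharZero k] {c : k} (hc : c ≠ 0)
  (A B : Submodule k (cyclicSpan (rightRegular k) (sphericalVector hstar u hsu hu0 hu hu' hϖ hs k c)
    (sphericalVector_mem_invariants hstar u hsu hu0 hu hu' hϖ hs k c)))
  (hA : ∀ (g : formUnitaryGroup (J3 u)) ⦃w⦄, w ∈ A →
    cyclicRep (rightRegular k) (sphericalVector hstar u hsu hu0 hu hu' hϖ hs k c)
      (sphericalVector_mem_invariants hstar u hsu hu0 hu hu' hϖ hs k c) g w ∈ A)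
  (hB : ∀ (g : formUnitaryGroup (J3 u)) ⦃w⦄, w ∈ B →
    cyclicRep (rightRegular k) (sphericalVector hstar u hsu hu0 hu hu' hϖ hs k c)
      (sphericalVector_mem_invariants hstar u hsu hu0 hu hu' hϖ hs k c) g w ∈ B)

include hc hA hB in
/-- **THE SPHERICAL LAYER OF `⟨G f₀⟩ ⊆ I(c)`**: a layer `A / B` carries a non-zero right-`K`-invariant vector iff
`f₀ ∈ A \ B`; with file 338 that layer, when irreducible, is `π_{χ_λ}`. -/
theorem layer_iff_sphericalVector :
    (∃ a ∈ A, a ∉ B ∧ ∀ κ ∈ hyperspecialSubgroup R (J3 u),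
        cyclicRep (rightRegular k) (sphericalVector hstar u hsu hu0 hu hu' hϖ hs k c)
          (sphericalVector_mem_invariants hstar u hsu hu0 hu hu' hϖ hs k c) κ a - a ∈ B) ↔
      gen (rightRegular k) (sphericalVector hstar u hsu hu0 hu hu' hϖ hs k c)
          (sphericalVector_mem_invariants hstar u hsu hu0 hu hu' hϖ hs k c) ∈ A ∧
        gen (rightRegular k) (sphericalVector hstar u hsu hu0 hu hu' hϖ hs k c)
          (sphericalVector_mem_invariants hstar u hsu hu0 hu hu' hϖ hs k c) ∉ B :=
  layer_iff (rightRegular k) _ _ (fun _ => inferInstance)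
    (exists_eq_smul_sphericalVector hstar u hsu hu0 hu hu' hϖ hs k hc) A B hA hB

include hc hA hB in
/-- The layer carrying the `K`-invariants of `⟨G f₀⟩` is the top layer: `A = ⟨G f₀⟩`. -/
theorem eq_top_of_layer_sphericalVector {a} (haA : a ∈ A) (haB : a ∉ B)
    (hinv : ∀ κ ∈ hyperspecialSubgroup R (J3 u),
      cyclicRep (rightRegular k) (sphericalVector hstar u hsu hu0 hu hu' hϖ hs k c)
        (sphericalVector_mem_invariants hstar u hsu hu0 hu hu' hϖ hs k c) κ a - a ∈ B) : A = ⊤ :=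
  eq_top_of_layer (rightRegular k) _ _ (fun _ => inferInstance)
    (exists_eq_smul_sphericalVector hstar u hsu hu0 hu hu' hϖ hs k hc) A B hA hB haA haB hinv

end Inert

end Summit.Ventures.HodgeRepro2.T5CyclicSubquotientLayer
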